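import Summits.AnomalousDissipation.AnomalousDissipation.Theorems.TwoAndHalfDTwohalfdNegCertificate
import Literature.Analysis.FluidPDE.LerayHopfMomentum
import Literature.Analysis.FluidPDE.LerayHopfSpectralMeasurability
import Literature.Analysis.FluidPDE.AlexakisDoeringProofs

/-!
# The purely vertical-force sub-case of the crux `TwoAndHalfD.TwohalfdNeg`
# (stmt-AnomalousDissipation-0211): `f = (0, 0, h(x₁,x₂))`, any source, any data, any momentum

A fourth unconditional sub-case of the crux on the line `log-kantorovich-enstrophy-transfer`
(siblings: single-shell planar force `Certificate.twohalfdNeg_twoHalf_singleShell`, zero source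
`ZeroSource…`, co-scalar source `Coscalar…`): if the `x₃`-invariant steady force is PURELY
VERTICAL, `f = twoHalf 0 h = (0, 0, h) ∘ π` with `h` ANY smooth mean-zero planar function, then
every bounded-energy family of `x₃`-invariant global Leray–Hopf solutions of NS_{ν_j}(`f`),
`ν_j → 0`, from arbitrary `L²` data has `meanDissipation → 0`.

The planar flow is then UNFORCED two-dimensional Navier–Stokes, whose strain has `limsup`-mean
ZERO at every fixed viscosity (`longTimeAvgSup_sqrt_eGradNormSq_eq_zero_of_unforced`: energy
inequality `ν∫₀ᵀ‖∇v‖² ≤ ‖v₀‖²` (FMRT (3.4) with zero force) and Jensen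
`T⁻¹∫₀ᵀ√Z ≤ (T⁻¹∫₀ᵀ Z)^{1/2} ≤ (‖v₀‖²/(νT))^{1/2} → 0`), so the force-wise residual
`SubLogStrainFor 0` holds trivially (`subLogStrainFor_zero`) and the line's per-force composition
(reduction S1' + S2 + S4 ⇒ S5' ⇒ S3') closes the sub-case (`twohalfdNeg_twoHalf_verticalForce`).
This is the paper sub-case (iii) of the disprover's work file (`Cruxes/TwohalfdNeg/Disproof.lean`,
cycle 1: "the long-time means of `w_j` are those of the laminar state swept by the drift"), now a
theorem WITHOUT the laminar/swept analysis: sub-log strain is all the engine needs.  Together with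
the three siblings: a counterexample to the crux needs a planar force on ≥ 2 shells AND a source
outside `ℝ·curl g`.  The file closes with the registered tools stub `stub_verticalForceCertificate`.
Supports stmt-AnomalousDissipation-0211.
-/

namespace Summit.AnomalousDissipation.AnomalousDissipation.Theorems.TwohalfdNeg.VerticalForce

open MeasureTheory Filter Topology Set
open scoped ENNReal NNReal
open Literature.Analysis.FunctionSpaces Literature.Analysis.FluidPDE
open Summit.AnomalousDissipation.AnomalousDissipation.Theorems.TwohalfdNeg

set_option linter.dupNamespace false

/-! ## Unforced planar Leray–Hopf solutions have zero mean strain -/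

/-- **Unforced 2-D Leray–Hopf flow: the `limsup`-mean strain vanishes at fixed viscosity.** For
`ν > 0` and a global Leray–Hopf solution `v` of the UNFORCED planar Navier–Stokes equations from
`L²` data, `⟨√‖∇v‖²⟩ = 0`: the running means obey
`T⁻¹∫₀ᵀ √‖∇v‖² ≤ (T⁻¹∫₀ᵀ ‖∇v‖²)^{1/2} ≤ (2·kineticEnergy v₀ /(νT))^{1/2} → 0`
(Jensen `timeMean_sqrt_le_sqrt_timeMean` and FMRT (3.4) with zero force,
`IsGlobalLerayHopf.toReal_lintegral_eGradNormSq_le_of_hasZeroMean`). [folklore] -/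
theorem longTimeAvgSup_sqrt_eGradNormSq_eq_zero_of_unforced {ν : ℝ} (hν : 0 < ν) {v₀ : (UnitAddTorus (Fin 2)) → (EuclideanSpace ℝ (Fin 2))}
    {v : ℝ → (UnitAddTorus (Fin 2)) → (EuclideanSpace ℝ (Fin 2))} (hv : Torus.IsGlobalLerayHopf ν (fun _ => (0 : (UnitAddTorus (Fin 2)) → (EuclideanSpace ℝ (Fin 2)))) v₀ v) :
    longTimeAvgSup (fun t => Real.sqrt (Torus.eGradNormSq (v t)).toReal) = 0 := by
  have hF : MemLp (0 : (UnitAddTorus (Fin 2)) → (EuclideanSpace ℝ (Fin 2))) 2 volume := MemLp.zero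
  have hF0 : Torus.HasZeroMean (0 : (UnitAddTorus (Fin 2)) → (EuclideanSpace ℝ (Fin 2))) := by
    simp [Torus.HasZeroMean]
  set C : ℝ := 2 * Torus.kineticEnergy v₀ / ν with hC
  have hC0 : 0 ≤ C := div_nonneg (mul_nonneg zero_le_two (Torus.kineticEnergy_nonneg _)) hν.le
  -- running means of the enstrophy: `T⁻¹∫₀ᵀ ‖∇v‖² ≤ C T⁻¹`
  have hZ : ∀ T, 0 < T → timeMean (fun t => (Torus.eGradNormSq (v t)).toReal) T ≤ C * T⁻¹ := by
    intro T hT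
    have H := hv T hT
    have hmeas := H.aemeasurable_eGradNormSq
    have hlt : ∀ᵐ τ ∂(volume.restrict (Ioo 0 T)), Torus.eGradNormSq (v τ) < ⊤ :=
      ae_lt_top' hmeas H.lintegral_eGradNormSq_lt_top.ne
    have hb := Torus.IsGlobalLerayHopf.toReal_lintegral_eGradNormSq_le_of_hasZeroMean hν hF hF0 hv hT.le
    have h0 : (∫ x, ‖(0 : (UnitAddTorus (Fin 2)) → (EuclideanSpace ℝ (Fin 2))) x‖ ^ 2) = 0 := by simp
    rw [h0, zero_div, zero_mul, add_zero] at hb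
    have hL : (∫⁻ τ in Ioo 0 T, Torus.eGradNormSq (v τ)).toReal ≤ C := by
      rw [hC, le_div_iff₀ hν, mul_comm]
      exact hb
    unfold timeMean
    rw [intervalIntegral.integral_of_le hT.le, integral_Ioc_eq_integral_Ioo, integral_toReal hmeas hlt,
      mul_comm]
    exact mul_le_mul_of_nonneg_right hL (inv_nonneg.2 hT.le)
  -- Jensen and squeeze
  have hint : ∀ T, 0 < T → IntegrableOn (fun t => (Torus.eGradNormSq (v t)).toReal) (Ioc 0 T) := by
    intro T hT
    have h := ReductionOffZero.integrableOn_dissipation hv hT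
    refine (h.const_mul ν⁻¹).congr ?_
    filter_upwards with t
    show ν⁻¹ * (ν * (Torus.eGradNormSq (v t)).toReal) = (Torus.eGradNormSq (v t)).toReal
    rw [← mul_assoc, inv_mul_cancel₀ hν.ne', one_mul]
  have hup : ∀ T, 0 < T →
      timeMean (fun t => Real.sqrt (Torus.eGradNormSq (v t)).toReal) T ≤ Real.sqrt (C * T⁻¹) := fun T hT =>
    (timeMean_sqrt_le_sqrt_timeMean hT (fun _ => ENNReal.toReal_nonneg) (hint T hT)).trans
      (Real.sqrt_le_sqrt (hZ T hT))
  have hlim : Tendsto (fun T : ℝ => Real.sqrt (C * T⁻¹)) atTop (𝓝 0) := by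
    have h := (tendsto_inv_atTop_zero.const_mul C).sqrt
    rwa [mul_zero, Real.sqrt_zero] at h
  have htm : Tendsto (timeMean fun t => Real.sqrt (Torus.eGradNormSq (v t)).toReal) atTop (𝓝 0) := by
    refine tendsto_of_tendsto_of_tendsto_of_le_of_le' tendsto_const_nhds hlim ?_ ?_
    · filter_upwards [eventually_ge_atTop (0 : ℝ)] with T hT
      exact timeMean_nonneg (fun _ => Real.sqrt_nonneg _) hT
    · filter_upwards [eventually_gt_atTop (0 : ℝ)] with T hT
      exact hup T hT
  exact htm.limsup_eq

/-- **`SubLogStrainFor 0`**: every global Leray–Hopf family of the UNFORCED planar Navier–Stokes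
equations has `⟨√‖∇v_j‖²⟩ / log(1/ν_j) → 0` (each numerator is `0`). [folklore] -/
theorem subLogStrainFor_zero :
    ∀ (ν : ℕ → ℝ) (v₀ : ℕ → (UnitAddTorus (Fin 2)) → (EuclideanSpace ℝ (Fin 2))) (v : ℕ → ℝ → (UnitAddTorus (Fin 2)) → (EuclideanSpace ℝ (Fin 2))),
      (∀ j, 0 < ν j) → Tendsto ν atTop (𝓝 0) →
      (∀ j, Torus.IsGlobalLerayHopf (ν j) (fun _ => (0 : (UnitAddTorus (Fin 2)) → (EuclideanSpace ℝ (Fin 2)))) (v₀ j) (v j)) →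
      (∃ E : ℝ, ∀ j, meanEnergy (v j) ≤ E) →
      Tendsto (fun j => longTimeAvgSup (fun t => Real.sqrt (Torus.eGradNormSq (v j t)).toReal) /
        Real.log (ν j)⁻¹) atTop (𝓝 0) := by
  intro ν v₀ v hν _hν0 hLH _hE
  have h0 : ∀ j, longTimeAvgSup (fun t => Real.sqrt (Torus.eGradNormSq (v j t)).toReal) = 0 := fun j =>
    longTimeAvgSup_sqrt_eGradNormSq_eq_zero_of_unforced (hν j) (hLH j)
  simp only [h0, zero_div]
  exact tendsto_const_nhds

/-! ## The sub-case -/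

/-- **The crux for purely vertical forces, unconditionally.** For ANY smooth mean-zero
`h : (UnitAddTorus (Fin 2)) → ℝ`, every family of `x₃`-invariant global Leray–Hopf solutions of NS_{ν_j} on `T³`
forced by the `x₃`-invariant steady vertical field `twoHalf 0 h = (0, 0, h) ∘ π`, with `ν_j → 0`,
arbitrary `L²` data (any momentum) and `ν`-uniformly bounded `limsup`-mean energy, has
`meanDissipation (ν j) (u j) → 0`. Reduction S1' (the returned planar force is `0`,
`twoHalf_left_injective`) + S2 + `subLogStrainFor_zero` + S4 ⇒ S5' ⇒ S3' + squeeze. [folklore] -/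
theorem twohalfdNeg_twoHalf_verticalForce :
    ∀ (h : (UnitAddTorus (Fin 2)) → ℝ), Torus.IsSmooth h → Torus.HasZeroMean h →
      ∀ (ν : ℕ → ℝ) (u₀ : ℕ → UnitAddTorus (Fin 3) → EuclideanSpace ℝ (Fin 3))
        (u : ℕ → ℝ → UnitAddTorus (Fin 3) → EuclideanSpace ℝ (Fin 3)),
        (∀ j, 0 < ν j) → Tendsto ν atTop (𝓝 0) →
        (∀ j, Torus.IsGlobalLerayHopf (ν j) (fun _ => Torus.twoHalf (0 : (UnitAddTorus (Fin 2)) → (EuclideanSpace ℝ (Fin 2))) h) (u₀ j) (u j)) →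
        (∀ j (t : ℝ) (s : UnitAddCircle) (x : UnitAddTorus (Fin 3)),
          u j t (x + Pi.single (2 : Fin 3) s) = u j t x) →
        (∃ E : ℝ, ∀ j, meanEnergy (u j) ≤ E) →
        Tendsto (fun j => meanDissipation (ν j) (u j)) atTop (𝓝 0) := by
  intro h hhs hhz ν u₀ u hν hν0 hLH huinv hE
  have hgs : Torus.IsSmooth (0 : (UnitAddTorus (Fin 2)) → (EuclideanSpace ℝ (Fin 2))) := Torus.isSmooth_const (0 : (EuclideanSpace ℝ (Fin 2)))
  have hgd : Torus.IsDivFree (0 : (UnitAddTorus (Fin 2)) → (EuclideanSpace ℝ (Fin 2))) := fun x => by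
    simp [Torus.divergence, Torus.partialDeriv, Torus.lineDeriv]
  have hgz : Torus.HasZeroMean (0 : (UnitAddTorus (Fin 2)) → (EuclideanSpace ℝ (Fin 2))) := by simp [Torus.HasZeroMean]
  have hfinv : ∀ (s : UnitAddCircle) (x : UnitAddTorus (Fin 3)),
      Torus.twoHalf (0 : (UnitAddTorus (Fin 2)) → (EuclideanSpace ℝ (Fin 2))) h (x + Pi.single (2 : Fin 3) s) = Torus.twoHalf (0 : (UnitAddTorus (Fin 2)) → (EuclideanSpace ℝ (Fin 2))) h x := by
    intro s x
    rw [Torus.twoHalf_eq_comp, Function.comp_apply, Function.comp_apply]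
    exact Torus.comp_planarProj_add_single (fun y => Torus.planarEmbed ((0 : (UnitAddTorus (Fin 2)) → (EuclideanSpace ℝ (Fin 2))) y, h y)) s x
  have hfs : Torus.IsSmooth (Torus.twoHalf (0 : (UnitAddTorus (Fin 2)) → (EuclideanSpace ℝ (Fin 2))) h) := hgs.twoHalf hhs
  have hfd : Torus.IsDivFree (Torus.twoHalf (0 : (UnitAddTorus (Fin 2)) → (EuclideanSpace ℝ (Fin 2))) h) := Torus.IsDivFree.twoHalf hgd h
  have hfz : Torus.HasZeroMean (Torus.twoHalf (0 : (UnitAddTorus (Fin 2)) → (EuclideanSpace ℝ (Fin 2))) h) :=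
    Torus.hasZeroMean_twoHalf hgs.continuous.integrable_unitAddTorus
      hhs.continuous.integrable_unitAddTorus hgz hhz
  obtain ⟨g', h', v₀, v, θ₀, θ, hgs', hgd', hgz', hhs', hhz', hfeq, -, hvLH, hθ₀, hθw, hEv, hEθ, hsplit⟩ :=
    ReductionOffZero.stub_reductionOffZero (Torus.twoHalf (0 : (UnitAddTorus (Fin 2)) → (EuclideanSpace ℝ (Fin 2))) h) hfinv hfs hfd hfz ν u₀ u hν
      hLH huinv hE
  obtain rfl : (0 : (UnitAddTorus (Fin 2)) → (EuclideanSpace ℝ (Fin 2))) = g' := Literature.Analysis.FluidPDE.Torus.twoHalf_left_injective hfeq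
  obtain rfl : h = h' := Literature.Analysis.FluidPDE.Torus.twoHalf_right_injective hfeq
  have hplanar : Tendsto (fun j => meanDissipation (ν j) (v j)) atTop (𝓝 0) :=
    PlanarNoAnomaly.stub_planarNoAnomaly (0 : (UnitAddTorus (Fin 2)) → (EuclideanSpace ℝ (Fin 2))) hgs hgd hgz ν v₀ v hν hν0 hvLH hEv
  have hsub := subLogStrainFor_zero ν v₀ v hν hν0 hvLH hEv
  have hquiet := QuietOfSubLogGrid.stub_quietOfSubLogGrid
    (ReleaseLogBound.stub_releaseLogBound (d := Fin 2)) (0 : (UnitAddTorus (Fin 2)) → (EuclideanSpace ℝ (Fin 2))) hgs hgd hgz ν v₀ v hν hν0 hvLH hEv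
    hsub h hhs hhz
  have hscalar : Tendsto (fun j => longTimeAvgSup
      (fun t => ν j * (Torus.eScalarGradNormSq (θ j t)).toReal)) atTop (𝓝 0) :=
    AgeDecouplingGrid.stub_ageDecouplingGrid (0 : (UnitAddTorus (Fin 2)) → (EuclideanSpace ℝ (Fin 2))) h hgs hgd hgz hhs hhz ν v₀ v θ₀ θ hν hvLH hEv
      hθ₀ hθw hEθ hquiet
  have hsum : Tendsto (fun j => meanDissipation (ν j) (v j) +
      longTimeAvgSup (fun t => ν j * (Torus.eScalarGradNormSq (θ j t)).toReal)) atTop (𝓝 0) := by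
    simpa using hplanar.add hscalar
  exact squeeze_zero (fun j => meanDissipation_nonneg (hν j).le (u j)) hsplit hsum


/-- **Registered tools stub `stub_verticalForceCertificate`** (conjunction of the two theorems of
this file, registered on stmt-AnomalousDissipation-0211 with `ledger workitem stub-add`):
`SubLogStrainFor 0` and the purely vertical-force sub-case of the crux. [folklore] -/
theorem stub_verticalForceCertificate :
    (∀ (ν : ℕ → ℝ) (v₀ : ℕ → UnitAddTorus (Fin 2) → EuclideanSpace ℝ (Fin 2)) (v : ℕ → ℝ → UnitAddTorus (Fin 2) → EuclideanSpace ℝ (Fin 2)), (∀ j, 0 < ν j) → Tendsto ν atTop (𝓝 0) → (∀ j, Torus.IsGlobalLerayHopf (ν j) (fun _ => (0 : UnitAddTorus (Fin 2) → EuclideanSpace ℝ (Fin 2))) (v₀ j) (v j)) → (∃ E : ℝ, ∀ j, meanEnergy (v j) ≤ E) → Tendsto (fun j => longTimeAvgSup (fun t => Real.sqrt (Torus.eGradNormSq (v j t)).toReal) / Real.log (ν j)⁻¹) atTop (𝓝 0)) ∧ (∀ (h : UnitAddTorus (Fin 2) → ℝ), Torus.IsSmooth h → Torus.HasZeroMean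 h → ∀ (ν : ℕ → ℝ) (u₀ : ℕ → UnitAddTorus (Fin 3) → EuclideanSpace ℝ (Fin 3)) (u : ℕ → ℝ → UnitAddTorus (Fin 3) → EuclideanSpace ℝ (Fin 3)), (∀ j, 0 < ν j) → Tendsto ν atTop (𝓝 0) → (∀ j, Torus.IsGlobalLerayHopf (ν j) (fun _ => Torus.twoHalf (0 : UnitAddTorus (Fin 2) → EuclideanSpace ℝ (Fin 2)) h) (u₀ j) (u j)) → (∀ j (t : ℝ) (s : UnitAddCircle) (x : UnitAddTorus (Fin 3)), u j t (x + Pi.single (2 : Fin 3) s) = u j t x) → (∃ E : ℝ, ∀ j, meanEnergy (u j) ≤ E) → Tendsto (fun j => meanDissipation (ν j) (u j)) atTop (𝓝 0)) :=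
  ⟨subLogStrainFor_zero, twohalfdNeg_twoHalf_verticalForce⟩

end Summit.AnomalousDissipation.AnomalousDissipation.Theorems.TwohalfdNeg.VerticalForce
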